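import Mathlib
import Literature.MathematicalPhysics.QuantumLattice.HubbardFreePropagator
import Literature.MathematicalPhysics.QuantumLattice.DiscreteSineTransform

/-!
# The Dirichlet sine basis of the `R × R` block: orthonormality, completeness, spectral identities

Topic `MathematicalPhysics/QuantumLattice` (family `hubbard`). On the offsets `u ∈ [0,R)²` of a square
block (free / Dirichlet boundary conditions) the product sine modes
`φ_j(u) = (2/(R+1)) Π_i sin(π (j_i+1)(u_i+1)/(R+1))`, `j ∈ [0,R)²`, form a REAL ORTHONORMAL BASIS
diagonalising every direction-weighted nearest-neighbour kernel
`K_w(u,u') = Σ_i w_i · [u' = u ± e_i inside the block]`, with eigenvalues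
`λ^w_j = Σ_i w_i · 2cos(π(j_i+1)/(R+1))`:

* `sum_chainMode_mul_chainMode` / `sum_blockMode_mul_blockMode` — orthonormality (from the discrete
  sine orthogonality `DiscreteSine.sum_Icc_sin_mul_sin`);
* `sum_blockMode_mul_blockMode_swap` — completeness `Σ_j φ_j(u) φ_j(u') = [u = u']`
  (`Matrix.mul_eq_one_comm`);
* `sum_blockKernel_mul_blockMode` — the eigen-equation `Σ_{u'} K_w(u,u') φ_j(u') = λ^w_j φ_j(u)` (the
  three-term recurrence of the chain sine, Dirichlet ends);
* `sum_blockEigen_mul_blockMode_mul_blockMode` — the **spectral identity**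
  `Σ_j λ^w_j φ_j(u) φ_j(u') = K_w(u,u')`.

With `w = (1,1)` the kernel is the block adjacency and `-λ_j = torusBand (2R+2) (j₁+1, j₂+1)` (the block
levels are torus levels of side `2R+2`, `blockEigen_one_one_eq_neg_torusBand`); with `w = (1,-1)` it is the
`d_{x²-y²}` bond kernel. This is the one-body input of the local kinetic-budget / block pair-order
estimates for the Hubbard torus. References: G. Strang, SIAM Rev. 41 (1999) 135, §2 (DST-I);
folklore. Definitions introduced (plain functions): `chainMode`, `blockMode`, `blockKernel`,
`blockEigen`. No named fact.
-/

namespace Literature.MathematicalPhysics.QuantumLattice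

open Finset Real Matrix Literature.Probability.LatticeModels

noncomputable section

variable (R : ℕ)

/-- The normalised chain sine mode `c_j(u) = √(2/(R+1)) sin(π(j+1)(u+1)/(R+1))` on `[0,R)`.
Strang, SIAM Rev. 41 (1999) 135, §2. [folklore] -/
def chainMode (j u : Fin R) : ℝ :=
  Real.sqrt (2 / ((R : ℝ) + 1)) * Real.sin (π * ((j : ℕ) + 1) * ((u : ℕ) + 1) / ((R : ℝ) + 1))

/-- The product sine mode `φ_j(u) = Π_i c_{j_i}(u_i)` on the block `[0,R)²`. [folklore] -/
def blockMode (j u : Fin 2 → Fin R) : ℝ := ∏ i, chainMode R (j i) (u i)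

/-- The direction-weighted nearest-neighbour kernel of the block (Dirichlet: neighbours outside the
block are absent): `K_w(u,u') = Σ_i Σ_{v : |v - u_i| = 1} w_i [u' = u with u_i ↦ v]`. [folklore] -/
def blockKernel (w : Fin 2 → ℝ) (u u' : Fin 2 → Fin R) : ℝ :=
  ∑ i, ∑ v : Fin R, if ((u i : ℕ) + 1 = v ∨ (v : ℕ) + 1 = u i) ∧ u' = Function.update u i v
    then w i else 0

/-- The eigenvalue `λ^w_j = Σ_i w_i · 2cos(π(j_i+1)/(R+1))` of `K_w` on `φ_j`. [folklore] -/
def blockEigen (w : Fin 2 → ℝ) (j : Fin 2 → Fin R) : ℝ :=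
  ∑ i, w i * (2 * Real.cos (π * ((j i : ℕ) + 1) / ((R : ℝ) + 1)))

/-! ### Orthonormality -/

/-- Chain orthonormality `Σ_u c_j(u) c_{j'}(u) = [j = j']`. [folklore] -/
theorem sum_chainMode_mul_chainMode (j j' : Fin R) :
    ∑ u : Fin R, chainMode R j u * chainMode R j' u = if j = j' then 1 else 0 := by
  have hR1 : (0 : ℝ) < (R : ℝ) + 1 := by positivity
  have h := DiscreteSine.sum_Icc_sin_mul_sin R (J := (j : ℕ) + 1) (J' := (j' : ℕ) + 1)
    (by omega) (by have := j.isLt; omega) (by omega) (by have := j'.isLt; omega)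
  -- reindex `u : Fin R ↦ U = u + 1 ∈ Icc 1 R`
  have hre : ∑ u : Fin R, Real.sin (π * ((j : ℕ) + 1) * ((u : ℕ) + 1) / ((R : ℝ) + 1)) *
      Real.sin (π * ((j' : ℕ) + 1) * ((u : ℕ) + 1) / ((R : ℝ) + 1)) =
      ∑ U ∈ Icc 1 R, Real.sin (π * (((j : ℕ) + 1 : ℕ) : ℝ) * U / (R + 1)) *
        Real.sin (π * (((j' : ℕ) + 1 : ℕ) : ℝ) * U / (R + 1)) := by
    set g : ℕ → ℝ := fun U => Real.sin (π * (((j : ℕ) + 1 : ℕ) : ℝ) * U / (R + 1)) *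
        Real.sin (π * (((j' : ℕ) + 1 : ℕ) : ℝ) * U / (R + 1)) with hg
    have h1 : ∑ u : Fin R, Real.sin (π * ((j : ℕ) + 1) * ((u : ℕ) + 1) / ((R : ℝ) + 1)) *
        Real.sin (π * ((j' : ℕ) + 1) * ((u : ℕ) + 1) / ((R : ℝ) + 1)) = ∑ u : Fin R, g ((u : ℕ) + 1) := by
      refine Finset.sum_congr rfl fun u _ => ?_
      simp only [hg]; push_cast; ring_nf
    rw [h1, Fin.sum_univ_eq_sum_range (fun k => g (k + 1)) R, ← Finset.Ico_add_one_right_eq_Icc,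
      Finset.sum_Ico_eq_sum_range]
    refine Finset.sum_congr (by simp) fun k _ => by rw [add_comm]
  have hsq : Real.sqrt (2 / ((R : ℝ) + 1)) * Real.sqrt (2 / ((R : ℝ) + 1)) = 2 / ((R : ℝ) + 1) :=
    Real.mul_self_sqrt (by positivity)
  calc ∑ u : Fin R, chainMode R j u * chainMode R j' u
      = Real.sqrt (2 / ((R : ℝ) + 1)) * Real.sqrt (2 / ((R : ℝ) + 1)) *
          ∑ u : Fin R, Real.sin (π * ((j : ℕ) + 1) * ((u : ℕ) + 1) / ((R : ℝ) + 1)) *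
            Real.sin (π * ((j' : ℕ) + 1) * ((u : ℕ) + 1) / ((R : ℝ) + 1)) := by
        rw [Finset.mul_sum]
        refine Finset.sum_congr rfl fun u _ => ?_
        simp only [chainMode]; ring
    _ = 2 / ((R : ℝ) + 1) * (if (j : ℕ) + 1 = (j' : ℕ) + 1 then ((R : ℝ) + 1) / 2 else 0) := by
        rw [hsq, hre, h]
    _ = if j = j' then 1 else 0 := by
        by_cases hjj : j = j'
        · subst hjj; simp only [if_true]; field_simp
        · rw [if_neg hjj, if_neg (fun h => hjj (Fin.ext (by omega))), mul_zero]

/-- Block orthonormality `Σ_u φ_j(u) φ_{j'}(u) = [j = j']`. [folklore] -/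
theorem sum_blockMode_mul_blockMode (j j' : Fin 2 → Fin R) :
    ∑ u : Fin 2 → Fin R, blockMode R j u * blockMode R j' u = if j = j' then 1 else 0 := by
  have h : ∑ u : Fin 2 → Fin R, blockMode R j u * blockMode R j' u =
      ∏ i : Fin 2, ∑ v : Fin R, chainMode R (j i) v * chainMode R (j' i) v := by
    rw [Finset.prod_univ_sum]
    refine Finset.sum_congr rfl fun u _ => ?_
    simp only [blockMode, ← Finset.prod_mul_distrib]
  rw [h]
  simp only [sum_chainMode_mul_chainMode]
  by_cases hjj : j = j'
  · subst hjj; simp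
  · rw [if_neg hjj]
    obtain ⟨i, hi⟩ : ∃ i, j i ≠ j' i := Function.ne_iff.1 hjj
    exact Finset.prod_eq_zero (Finset.mem_univ i) (if_neg hi)

/-- Completeness `Σ_j φ_j(u) φ_j(u') = [u = u']` (a square real matrix with orthonormal rows has
orthonormal columns). [folklore] -/
theorem sum_blockMode_mul_blockMode_swap (u u' : Fin 2 → Fin R) :
    ∑ j : Fin 2 → Fin R, blockMode R j u * blockMode R j u' = if u = u' then 1 else 0 := by
  set M : Matrix (Fin 2 → Fin R) (Fin 2 → Fin R) ℝ := fun j u => blockMode R j u with hM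
  have hrow : M * Mᵀ = 1 := by
    ext j j'
    simp only [Matrix.mul_apply, Matrix.transpose_apply, Matrix.one_apply, hM]
    exact sum_blockMode_mul_blockMode R j j'
  have hcol : Mᵀ * M = 1 := mul_eq_one_comm.1 hrow
  have h := congrFun (congrFun hcol u) u'
  simp only [Matrix.mul_apply, Matrix.transpose_apply, Matrix.one_apply, hM] at h
  exact h

/-! ### The eigen-equation and the spectral identity -/

/-- The chain sine with its Dirichlet ends: the `ℤ`-extension `U ↦ sin(π(j+1)U/(R+1))` vanishes at
`U = 0` and `U = R + 1`, so the neighbour sum inside `[0,R)` is the full three-term sum.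
`Σ_{v : |v-u| = 1} c_j(v) = 2cos(π(j+1)/(R+1)) c_j(u)`. [folklore] -/
theorem sum_neighbour_chainMode (j u : Fin R) :
    ∑ v : Fin R, (if (u : ℕ) + 1 = v ∨ (v : ℕ) + 1 = u then chainMode R j v else 0) =
      2 * Real.cos (π * ((j : ℕ) + 1) / ((R : ℝ) + 1)) * chainMode R j u := by
  classical
  have hR1 : (0 : ℝ) < (R : ℝ) + 1 := by positivity
  set θ : ℝ := π * ((j : ℕ) + 1) / ((R : ℝ) + 1) with hθ
  set S : ℝ → ℝ := fun U => Real.sqrt (2 / ((R : ℝ) + 1)) * Real.sin (θ * U) with hS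
  have hSc : ∀ v : Fin R, chainMode R j v = S ((v : ℕ) + 1) := fun v => by
    simp only [hS, hθ, chainMode]; congr 2; ring
  -- the three-term recurrence at `U = u + 1`
  have hrec : S ((u : ℕ) + 1 - 1) + S ((u : ℕ) + 1 + 1) = 2 * Real.cos θ * S ((u : ℕ) + 1) := by
    simp only [hS]
    rw [← mul_add, DiscreteSine.sin_chain_recurrence]; ring
  -- Dirichlet ends
  have hS0 : S 0 = 0 := by simp [hS]
  have hSR : S ((R : ℝ) + 1) = 0 := by
    simp only [hS, hθ]
    rw [show π * ((j : ℕ) + 1) / ((R : ℝ) + 1) * ((R : ℝ) + 1) = (((j : ℕ) + 1 : ℕ) : ℝ) * π by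
      push_cast; field_simp, Real.sin_nat_mul_pi, mul_zero]
  -- split the neighbour sum into the lower and the upper neighbour
  have hsplit : ∀ v : Fin R, (if (u : ℕ) + 1 = v ∨ (v : ℕ) + 1 = u then chainMode R j v else 0) =
      (if (u : ℕ) + 1 = v then chainMode R j v else 0) +
        (if (v : ℕ) + 1 = u then chainMode R j v else 0) := by
    intro v
    by_cases h1 : (u : ℕ) + 1 = v
    · have h2 : ¬ ((v : ℕ) + 1 = u) := by omega
      simp [h1, h2]
    · by_cases h2 : (v : ℕ) + 1 = u
      · simp [h1, h2]
      · simp [h1, h2]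
  simp_rw [hsplit]
  rw [Finset.sum_add_distrib]
  -- upper neighbour
  have hup : ∑ v : Fin R, (if (u : ℕ) + 1 = v then chainMode R j v else 0) = S ((u : ℕ) + 1 + 1) := by
    by_cases hu : (u : ℕ) + 1 < R
    · rw [Finset.sum_eq_single ⟨(u : ℕ) + 1, hu⟩]
      · simp only [if_true, hSc]; push_cast; ring_nf
      · intro v _ hv
        rw [if_neg]
        intro h; exact hv (Fin.ext (by simp [← h]))
      · intro h; exact absurd (Finset.mem_univ _) h
    · have hR : (u : ℕ) + 1 = R := by have := u.isLt; omega
      rw [Finset.sum_eq_zero (fun v _ => if_neg (by have := v.isLt; omega))]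
      rw [show ((u : ℕ) : ℝ) + 1 + 1 = (R : ℝ) + 1 by exact_mod_cast congrArg (· + 1) hR, hSR]
  -- lower neighbour
  have hlow : ∑ v : Fin R, (if (v : ℕ) + 1 = u then chainMode R j v else 0) = S ((u : ℕ) + 1 - 1) := by
    by_cases hu : 1 ≤ (u : ℕ)
    · rw [Finset.sum_eq_single ⟨(u : ℕ) - 1, by have := u.isLt; omega⟩]
      · rw [if_pos (by simp only; omega), hSc]
        congr 1
        push_cast [Nat.cast_sub hu]
        ring
      · intro v _ hv
        rw [if_neg]
        intro h; exact hv (Fin.ext (by simp only; omega))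
      · intro h; exact absurd (Finset.mem_univ _) h
    · have h0 : (u : ℕ) = 0 := by omega
      rw [Finset.sum_eq_zero (fun v _ => if_neg (by omega))]
      rw [show ((u : ℕ) : ℝ) + 1 - 1 = 0 by rw [h0]; push_cast; ring, hS0]
  rw [hup, hlow, add_comm, hrec, hSc]

/-- **Eigen-equation**: `Σ_{u'} K_w(u,u') φ_j(u') = λ^w_j φ_j(u)`. [folklore] -/
theorem sum_blockKernel_mul_blockMode (w : Fin 2 → ℝ) (j u : Fin 2 → Fin R) :
    ∑ u' : Fin 2 → Fin R, blockKernel R w u u' * blockMode R j u' = blockEigen R w j * blockMode R j u := by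
  classical
  -- `Σ_{u'} K(u,u') f(u') = Σ_i Σ_v w_i [|v - u_i| = 1] f(u[i ↦ v])`
  have hK : ∑ u' : Fin 2 → Fin R, blockKernel R w u u' * blockMode R j u' =
      ∑ i : Fin 2, ∑ v : Fin R, (if (u i : ℕ) + 1 = v ∨ (v : ℕ) + 1 = u i then
        w i * blockMode R j (Function.update u i v) else 0) := by
    simp only [blockKernel, Finset.sum_mul]
    rw [Finset.sum_comm]
    refine Finset.sum_congr rfl fun i _ => ?_
    rw [Finset.sum_comm]
    refine Finset.sum_congr rfl fun v _ => ?_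
    by_cases hv : (u i : ℕ) + 1 = v ∨ (v : ℕ) + 1 = u i
    · simp only [hv, true_and, ite_mul, zero_mul]
      rw [Finset.sum_ite_eq' Finset.univ (Function.update u i v) (fun u' => w i * blockMode R j u')]
      simp
    · simp [hv]
  rw [hK]
  -- in direction `i` the mode factorises: `φ_j(u[i ↦ v]) = c_{j_i}(v) · Π_{i' ≠ i} c_{j_{i'}}(u_{i'})`
  have hfac : ∀ (i : Fin 2) (v : Fin R), blockMode R j (Function.update u i v) =
      chainMode R (j i) v * ∏ i' ∈ Finset.univ.erase i, chainMode R (j i') (u i') := by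
    intro i v
    rw [blockMode, ← Finset.mul_prod_erase _ _ (Finset.mem_univ i), Function.update_self]
    congr 1
    exact Finset.prod_congr rfl fun i' hi' => by rw [Function.update_of_ne (Finset.ne_of_mem_erase hi')]
  have hfac0 : ∀ i : Fin 2, blockMode R j u =
      chainMode R (j i) (u i) * ∏ i' ∈ Finset.univ.erase i, chainMode R (j i') (u i') := fun i => by
    rw [blockMode, ← Finset.mul_prod_erase _ _ (Finset.mem_univ i)]
  calc ∑ i : Fin 2, ∑ v : Fin R, (if (u i : ℕ) + 1 = v ∨ (v : ℕ) + 1 = u i then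
          w i * blockMode R j (Function.update u i v) else 0)
      = ∑ i : Fin 2, w i * (∏ i' ∈ Finset.univ.erase i, chainMode R (j i') (u i')) *
          ∑ v : Fin R, (if (u i : ℕ) + 1 = v ∨ (v : ℕ) + 1 = u i then chainMode R (j i) v else 0) := by
        refine Finset.sum_congr rfl fun i _ => ?_
        rw [Finset.mul_sum]
        refine Finset.sum_congr rfl fun v _ => ?_
        split_ifs
        · rw [hfac]; ring
        · rw [mul_zero]
    _ = ∑ i : Fin 2, w i * (2 * Real.cos (π * ((j i : ℕ) + 1) / ((R : ℝ) + 1))) * blockMode R j u := by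
        refine Finset.sum_congr rfl fun i _ => ?_
        rw [sum_neighbour_chainMode, hfac0 i]; ring
    _ = blockEigen R w j * blockMode R j u := by rw [blockEigen, Finset.sum_mul]

/-- **Spectral identity**: `Σ_j λ^w_j φ_j(u) φ_j(u') = K_w(u,u')`. [folklore] -/
theorem sum_blockEigen_mul_blockMode_mul_blockMode (w : Fin 2 → ℝ) (u u' : Fin 2 → Fin R) :
    ∑ j : Fin 2 → Fin R, blockEigen R w j * blockMode R j u * blockMode R j u' = blockKernel R w u u' := by
  calc ∑ j : Fin 2 → Fin R, blockEigen R w j * blockMode R j u * blockMode R j u'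
      = ∑ j : Fin 2 → Fin R, (∑ u'' : Fin 2 → Fin R, blockKernel R w u u'' * blockMode R j u'') *
          blockMode R j u' := by
        refine Finset.sum_congr rfl fun j _ => ?_
        rw [sum_blockKernel_mul_blockMode]
    _ = ∑ u'' : Fin 2 → Fin R, blockKernel R w u u'' *
          ∑ j : Fin 2 → Fin R, blockMode R j u'' * blockMode R j u' := by
        simp only [Finset.sum_mul, Finset.mul_sum]
        rw [Finset.sum_comm]
        refine Finset.sum_congr rfl fun u'' _ => Finset.sum_congr rfl fun j _ => by ring
    _ = blockKernel R w u u' := by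
        simp only [sum_blockMode_mul_blockMode_swap, mul_ite, mul_one, mul_zero, Finset.sum_ite_eq',
          Finset.mem_univ, if_true]

/-- The kernel is symmetric. [folklore] -/
theorem blockKernel_comm (w : Fin 2 → ℝ) (u u' : Fin 2 → Fin R) :
    blockKernel R w u u' = blockKernel R w u' u := by
  rw [← sum_blockEigen_mul_blockMode_mul_blockMode, ← sum_blockEigen_mul_blockMode_mul_blockMode]
  exact Finset.sum_congr rfl fun j _ => by ring

/-- With unit weights the block eigenvalues are minus the torus band of side `2R + 2` at the momenta
`(j₁+1, j₂+1)`: `λ^{(1,1)}_j = -torusBand (2R+2) (j+1)`. [folklore] -/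
theorem blockEigen_one_one_eq_neg_torusBand (j : Fin 2 → Fin R) :
    blockEigen R (fun _ => 1) j =
      -torusBand (2 * R + 2) (fun i => ((((j i : ℕ) + 1 : ℕ)) : ZMod (2 * R + 2))) := by
  have hval : ∀ i, ((((j i : ℕ) + 1 : ℕ) : ZMod (2 * R + 2))).val = (j i : ℕ) + 1 := fun i => by
    rw [ZMod.val_natCast, Nat.mod_eq_of_lt (by have := (j i).isLt; omega)]
  simp only [blockEigen, torusBand, latticeMomentum, hval, one_mul, neg_mul, neg_neg]
  rw [Finset.mul_sum]
  refine Finset.sum_congr rfl fun i _ => ?_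
  have harg : π * (((j i : ℕ) : ℝ) + 1) / ((R : ℝ) + 1) =
      2 * π * ((((j i : ℕ) + 1 : ℕ) : ℕ) : ℝ) / ((2 * R + 2 : ℕ) : ℝ) := by
    push_cast
    field_simp
  rw [harg]

end

end Literature.MathematicalPhysics.QuantumLattice
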